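import Mathlib
import Summits.Ventures.PercRepro2.SwOutCrossBaseDefs

/-!
# The cross base: the classes are disjoint, the realisation on each class, injectivity (blind cell
PercRepro2, night-4 g23, 2026-08-28; proofs/NIGHT4-G23.md §10, step (1))

The five kinds of classes of a cross base (the edges touching a far arm, touching a u-arm, the
u–`p i` edges, the cross edges of a pair, the outside edges of `p i`) are pairwise disjoint, so the
realisation of a point is, on a class, the base colour or its flip according to the coordinate
(`crossReal_apply_*`), and two points with the same realisation agree on every coordinate whose
class has an edge — **`crossReal_injective`** (every u-arm joined to `u`, every far arm with an
edge, every dropped vertex with a u-edge and an outside edge, every edge of `G` realised).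
-/

namespace Summit.Ventures.PercRepro2

namespace CrossArm

open Hull LocRows

variable {V : Type*} {E : Type*}

open scoped Classical

section Disj

variable {ends : E → Sym2 V} {σ : Config E} {h u : V} {ι X κ : Type*} {U : ι → Set V}
  {p : X → V} {G : SimpleGraph X} {F : κ → Set V} (hb : CrossBase ends σ h u U p G F)
include hb

/-- An edge touching `U j` touches no other u-arm. -/
lemma CrossBase.touches_U_disj {j j' : ι} (hne : j ≠ j') {e : E} (he : e ∈ touches ends (U j)) :
    e ∉ touches ends (U j') := by
  intro he'
  obtain ⟨x, hx, y, hxy⟩ := he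
  obtain ⟨x', hx', y', hxy'⟩ := he'
  rw [hxy, Sym2.eq_iff] at hxy'
  rcases hxy' with ⟨h1, -⟩ | ⟨-, h2⟩
  · rw [← h1] at hx'
    exact hb.U_disj j j' hne x hx hx'
  · rw [← h2] at hx'
    exact hb.no_cross_UU j j' hne e x y hxy hx hx'

/-- An edge touching `U j` touches no far arm. -/
lemma CrossBase.touches_U_F_disj {j : ι} {k : κ} {e : E} (he : e ∈ touches ends (U j)) :
    e ∉ touches ends (F k) := by
  intro he'
  obtain ⟨x, hx, y, hxy⟩ := he
  obtain ⟨x', hx', y', hxy'⟩ := he'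
  rw [hxy, Sym2.eq_iff] at hxy'
  rcases hxy' with ⟨h1, -⟩ | ⟨-, h2⟩
  · rw [← h1] at hx'
    exact hb.U_disj_F j k x hx hx'
  · rw [← h2] at hx'
    exact hb.no_cross_UF j k e x y hxy hx hx'

/-- An edge touching `F k` touches no other far arm. -/
lemma CrossBase.touches_F_disj {k k' : κ} (hne : k ≠ k') {e : E} (he : e ∈ touches ends (F k)) :
    e ∉ touches ends (F k') := by
  intro he'
  obtain ⟨x, hx, y, hxy⟩ := he
  obtain ⟨x', hx', y', hxy'⟩ := he'
  rw [hxy, Sym2.eq_iff] at hxy'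
  rcases hxy' with ⟨h1, -⟩ | ⟨-, h2⟩
  · rw [← h1] at hx'
    exact hb.F_disj k k' hne x hx hx'
  · rw [← h2] at hx'
    exact hb.no_cross_FF k k' hne e x y hxy hx hx'

/-- A u–`p i` edge touches no u-arm and no far arm, is no cross edge and no outside edge. -/
lemma CrossBase.clsUPX_not_touches {i : X} {e : E} (he : e ∈ clsUPX ends u p i) :
    (∀ j, e ∉ touches ends (U j)) ∧ (∀ k, e ∉ touches ends (F k)) ∧
      (∀ s, e ∉ clsCX ends p G s) ∧ ∀ i', e ∉ clsExtX ends u p i' := by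
  have he' : ends e = s(u, p i) := he
  refine ⟨fun j hj => ?_, fun k hk => ?_, fun s hs => ?_, fun i' hi' => ?_⟩
  · obtain ⟨x, hx, y, hxy⟩ := hj
    rw [he', Sym2.eq_iff] at hxy
    rcases hxy with ⟨h1, -⟩ | ⟨-, h2⟩
    · rw [← h1] at hx; exact hb.u_notMem_U j hx
    · rw [← h2] at hx; exact hb.p_notMem_U i j hx
  · obtain ⟨x, hx, y, hxy⟩ := hk
    rw [he', Sym2.eq_iff] at hxy
    rcases hxy with ⟨h1, -⟩ | ⟨-, h2⟩
    · rw [← h1] at hx; exact hb.u_notMem_F k hx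
    · rw [← h2] at hx; exact hb.p_notMem_F i k hx
  · obtain ⟨a, b, -, hab⟩ := hs
    rw [he', Sym2.eq_iff] at hab
    rcases hab with ⟨h1, -⟩ | ⟨h1, -⟩
    · exact hb.hne_up a h1
    · exact hb.hne_up b h1
  · obtain ⟨x, hx, hxu, -⟩ := hi'
    rw [he', Sym2.eq_iff] at hx
    rcases hx with ⟨h1, -⟩ | ⟨h1, -⟩
    · exact hb.hne_up i' h1
    · exact hxu h1.symm

/-- Two u–`p` classes of distinct dropped vertices are disjoint. -/
lemma CrossBase.clsUPX_disj {i i' : X} (hne : i ≠ i') {e : E} (he : e ∈ clsUPX ends u p i) :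
    e ∉ clsUPX ends u p i' := by
  intro he'
  have h1 : ends e = s(u, p i) := he
  have h2 : ends e = s(u, p i') := he'
  rw [h1, Sym2.eq_iff] at h2
  rcases h2 with ⟨-, h⟩ | ⟨h, -⟩
  · exact hne (hb.p_inj h)
  · exact hb.hne_up i' h

/-- A cross edge touches no u-arm and no far arm and is no outside edge. -/
lemma CrossBase.clsCX_not_touches {s : G.edgeSet} {e : E} (he : e ∈ clsCX ends p G s) :
    (∀ j, e ∉ touches ends (U j)) ∧ (∀ k, e ∉ touches ends (F k)) ∧
      ∀ i', e ∉ clsExtX ends u p i' := by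
  obtain ⟨a, b, -, hab⟩ := he
  refine ⟨fun j hj => ?_, fun k hk => ?_, fun i' hi' => ?_⟩
  · obtain ⟨x, hx, y, hxy⟩ := hj
    rw [hab, Sym2.eq_iff] at hxy
    rcases hxy with ⟨h1, -⟩ | ⟨-, h2⟩
    · rw [← h1] at hx; exact hb.p_notMem_U a j hx
    · rw [← h2] at hx; exact hb.p_notMem_U b j hx
  · obtain ⟨x, hx, y, hxy⟩ := hk
    rw [hab, Sym2.eq_iff] at hxy
    rcases hxy with ⟨h1, -⟩ | ⟨-, h2⟩
    · rw [← h1] at hx; exact hb.p_notMem_F a k hx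
    · rw [← h2] at hx; exact hb.p_notMem_F b k hx
  · obtain ⟨x, hx, -, hxp⟩ := hi'
    rw [hab, Sym2.eq_iff] at hx
    rcases hx with ⟨-, h2⟩ | ⟨h1, -⟩
    · exact hxp b h2.symm
    · exact hxp a h1.symm

/-- Two cross classes of distinct pairs are disjoint. -/
lemma CrossBase.clsCX_disj {s s' : G.edgeSet} (hne : s ≠ s') {e : E} (he : e ∈ clsCX ends p G s) :
    e ∉ clsCX ends p G s' := by
  intro he'
  obtain ⟨a, b, hs, hab⟩ := he
  obtain ⟨a', b', hs', hab'⟩ := he'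
  apply hne
  apply Subtype.ext
  rw [hs, hs']
  rw [hab, Sym2.eq_iff] at hab'
  rcases hab' with ⟨h1, h2⟩ | ⟨h1, h2⟩
  · rw [hb.p_inj h1, hb.p_inj h2]
  · rw [hb.p_inj h1, hb.p_inj h2, Sym2.eq_swap]

/-- An outside edge of `p i` touches no u-arm and no far arm. -/
lemma CrossBase.clsExtX_not_touches {i : X} {e : E} (he : e ∈ clsExtX ends u p i) :
    (∀ j, e ∉ touches ends (U j)) ∧ ∀ k, e ∉ touches ends (F k) := by
  obtain ⟨x, hx, -, -⟩ := he
  refine ⟨fun j hj => ?_, fun k hk => ?_⟩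
  · obtain ⟨y, hy, z, hyz⟩ := hj
    rw [hx, Sym2.eq_iff] at hyz
    rcases hyz with ⟨h1, -⟩ | ⟨-, h2⟩
    · rw [← h1] at hy; exact hb.p_notMem_U i j hy
    · rw [← h2] at hy; exact hb.no_pU hx j hy
  · obtain ⟨y, hy, z, hyz⟩ := hk
    rw [hx, Sym2.eq_iff] at hyz
    rcases hyz with ⟨h1, -⟩ | ⟨-, h2⟩
    · rw [← h1] at hy; exact hb.p_notMem_F i k hy
    · rw [← h2] at hy; exact hb.no_pF hx k hy

/-- Two outside classes of distinct dropped vertices are disjoint. -/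
lemma CrossBase.clsExtX_disj {i i' : X} (hne : i ≠ i') {e : E} (he : e ∈ clsExtX ends u p i) :
    e ∉ clsExtX ends u p i' := by
  intro he'
  obtain ⟨x, hx, -, hxp⟩ := he
  obtain ⟨x', hx', -, hxp'⟩ := he'
  rw [hx, Sym2.eq_iff] at hx'
  rcases hx' with ⟨h1, -⟩ | ⟨h1, -⟩
  · exact hne (hb.p_inj h1)
  · exact hxp' i h1.symm

end Disj

section Apply

variable {ends : E → Sym2 V} {σ : Config E} {h u : V} {ι X κ : Type*} {U : ι → Set V}
  {p : X → V} {G : SimpleGraph X} {F : κ → Set V} (hb : CrossBase ends σ h u U p G F)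
include hb

/-- On an edge touching `F k`. -/
lemma CrossBase.crossReal_apply_F {q : PtXG ι κ X G} {k : κ} {e : E}
    (he : e ∈ touches ends (F k)) :
    crossReal ends u U p G F σ q e = (if q.1 k = true then σ e else !σ e) := by
  unfold crossReal
  by_cases hk : q.1 k = true
  · rw [if_pos hk, if_neg]
    rintro ((((⟨k', hk', he'⟩ | ⟨j, _, he'⟩) | ⟨i, _, he'⟩) | ⟨s, _, he'⟩) | ⟨i, _, he'⟩)
    · by_cases hkk : k = k'
      · subst hkk; rw [hk] at hk'; exact absurd hk' (by decide)
      · exact hb.touches_F_disj hkk he he'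
    · exact hb.touches_U_F_disj he' he
    · exact (hb.clsUPX_not_touches he').2.1 k he
    · exact (hb.clsCX_not_touches he').2.1 k he
    · exact (hb.clsExtX_not_touches he').2 k he
  · rw [if_neg hk, if_pos]
    exact Or.inl (Or.inl (Or.inl (Or.inl ⟨k, by simpa using hk, he⟩)))

/-- On an edge touching `U j`. -/
lemma CrossBase.crossReal_apply_U {q : PtXG ι κ X G} {j : ι} {e : E}
    (he : e ∈ touches ends (U j)) :
    crossReal ends u U p G F σ q e = (if q.2.1 j = true then σ e else !σ e) := by
  unfold crossReal
  by_cases hj : q.2.1 j = true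
  · rw [if_pos hj, if_neg]
    rintro ((((⟨k, _, he'⟩ | ⟨j', hj', he'⟩) | ⟨i, _, he'⟩) | ⟨s, _, he'⟩) | ⟨i, _, he'⟩)
    · exact hb.touches_U_F_disj he he'
    · by_cases hjj : j = j'
      · subst hjj; rw [hj] at hj'; exact absurd hj' (by decide)
      · exact hb.touches_U_disj hjj he he'
    · exact (hb.clsUPX_not_touches he').1 j he
    · exact (hb.clsCX_not_touches he').1 j he
    · exact (hb.clsExtX_not_touches he').1 j he
  · rw [if_neg hj, if_pos]
    exact Or.inl (Or.inl (Or.inl (Or.inr ⟨j, by simpa using hj, he⟩)))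

/-- On a u–`p i` edge. -/
lemma CrossBase.crossReal_apply_UP {q : PtXG ι κ X G} {i : X} {e : E}
    (he : e ∈ clsUPX ends u p i) :
    crossReal ends u U p G F σ q e = (if q.2.2.1 i = true then σ e else !σ e) := by
  unfold crossReal
  by_cases hi : q.2.2.1 i = true
  · rw [if_pos hi, if_neg]
    rintro ((((⟨k, _, he'⟩ | ⟨j, _, he'⟩) | ⟨i', hi', he'⟩) | ⟨s, _, he'⟩) | ⟨i', _, he'⟩)
    · exact (hb.clsUPX_not_touches he).2.1 k he'
    · exact (hb.clsUPX_not_touches he).1 j he'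
    · by_cases hii : i = i'
      · subst hii; rw [hi] at hi'; exact absurd hi' (by decide)
      · exact hb.clsUPX_disj hii he he'
    · exact (hb.clsUPX_not_touches he).2.2.1 s he'
    · exact (hb.clsUPX_not_touches he).2.2.2 i' he'
  · rw [if_neg hi, if_pos]
    exact Or.inl (Or.inl (Or.inr ⟨i, by simpa using hi, he⟩))

/-- On a cross edge of the pair `s`. -/
lemma CrossBase.crossReal_apply_C {q : PtXG ι κ X G} {s : G.edgeSet} {e : E}
    (he : e ∈ clsCX ends p G s) :
    crossReal ends u U p G F σ q e = (if q.2.2.2.1 s = true then σ e else !σ e) := by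
  unfold crossReal
  by_cases hs : q.2.2.2.1 s = true
  · rw [if_pos hs, if_neg]
    rintro ((((⟨k, _, he'⟩ | ⟨j, _, he'⟩) | ⟨i, _, he'⟩) | ⟨s', hs', he'⟩) | ⟨i, _, he'⟩)
    · exact (hb.clsCX_not_touches he).2.1 k he'
    · exact (hb.clsCX_not_touches he).1 j he'
    · exact (hb.clsUPX_not_touches he').2.2.1 s he
    · by_cases hss : s = s'
      · subst hss; rw [hs] at hs'; exact absurd hs' (by decide)
      · exact hb.clsCX_disj hss he he'
    · exact (hb.clsCX_not_touches he).2.2 i he'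
  · rw [if_neg hs, if_pos]
    exact Or.inl (Or.inr ⟨s, by simpa using hs, he⟩)

/-- On an outside edge of `p i`. -/
lemma CrossBase.crossReal_apply_Ext {q : PtXG ι κ X G} {i : X} {e : E}
    (he : e ∈ clsExtX ends u p i) :
    crossReal ends u U p G F σ q e = (if q.2.2.2.2 i = true then σ e else !σ e) := by
  unfold crossReal
  by_cases hi : q.2.2.2.2 i = true
  · rw [if_pos hi, if_neg]
    rintro ((((⟨k, _, he'⟩ | ⟨j, _, he'⟩) | ⟨i', _, he'⟩) | ⟨s, _, he'⟩) | ⟨i', hi', he'⟩)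
    · exact (hb.clsExtX_not_touches he).2 k he'
    · exact (hb.clsExtX_not_touches he).1 j he'
    · exact (hb.clsUPX_not_touches he').2.2.2 i he
    · exact (hb.clsCX_not_touches he').2.2 i he
    · by_cases hii : i = i'
      · subst hii; rw [hi] at hi'; exact absurd hi' (by decide)
      · exact hb.clsExtX_disj hii he he'
  · rw [if_neg hi, if_pos]
    exact Or.inr ⟨i, by simpa using hi, he⟩

end Apply

section Inj

variable {ends : E → Sym2 V} {σ : Config E} {h u : V} {ι X κ : Type*} {U : ι → Set V}
  {p : X → V} {G : SimpleGraph X} {F : κ → Set V}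

/-- Two points with the same realisation agree on a class with an edge. -/
lemma coord_eq_of_crossReal_eq {q q' : PtXG ι κ X G}
    (hqq : crossReal ends u U p G F σ q = crossReal ends u U p G F σ q') {e : E}
    {b b' : Bool} (hq : crossReal ends u U p G F σ q e = (if b = true then σ e else !σ e))
    (hq' : crossReal ends u U p G F σ q' e = (if b' = true then σ e else !σ e)) : b = b' := by
  have := congrFun hqq e
  rw [hq, hq'] at this
  cases b <;> cases b' <;> simp_all

variable (hb : CrossBase ends σ h u U p G F)
include hb

/-- **The realisation is injective** when every class has an edge: an edge at every far arm, a
u–`p i` edge and an outside edge at every dropped vertex, an edge for every edge of `G`. -/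
theorem CrossBase.crossReal_injective (hFe : ∀ k, ∃ e, e ∈ touches ends (F k))
    (hup : ∀ i, ∃ e, ends e = s(u, p i)) (hcross : ∀ s : G.edgeSet, ∃ e, e ∈ clsCX ends p G s)
    (hext : ∀ i, ∃ e, e ∈ clsExtX ends u p i) :
    Function.Injective (crossReal ends u U p G F σ : PtXG ι κ X G → Config E) := by
  intro q q' hqq
  obtain ⟨f, s, uP, c, e⟩ := q
  obtain ⟨f', s', uP', c', e'⟩ := q'
  simp only [Prod.mk.injEq]
  refine ⟨?_, ?_, ?_, ?_, ?_⟩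
  · funext k
    obtain ⟨e₀, ht⟩ := hFe k
    exact coord_eq_of_crossReal_eq hqq (hb.crossReal_apply_F ht) (hb.crossReal_apply_F ht)
  · funext j
    obtain ⟨e₀, x, hex, hx⟩ := hb.u_adj_U j
    have ht : e₀ ∈ touches ends (U j) := ⟨x, hx, u, ends_swap hex⟩
    exact coord_eq_of_crossReal_eq hqq (hb.crossReal_apply_U ht) (hb.crossReal_apply_U ht)
  · funext i
    obtain ⟨e₀, hup'⟩ := hup i
    exact coord_eq_of_crossReal_eq hqq (hb.crossReal_apply_UP hup') (hb.crossReal_apply_UP hup')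
  · funext t
    obtain ⟨e₀, ht⟩ := hcross t
    exact coord_eq_of_crossReal_eq hqq (hb.crossReal_apply_C ht) (hb.crossReal_apply_C ht)
  · funext i
    obtain ⟨e₀, ht⟩ := hext i
    exact coord_eq_of_crossReal_eq hqq (hb.crossReal_apply_Ext ht) (hb.crossReal_apply_Ext ht)

end Inj

end CrossArm

end Summit.Ventures.PercRepro2
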